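import Mathlib
import Summits.Parity.BatemanHorn.Theorems.IsogenyRedeiTypeIMainTermComponents
import Summits.Parity.BatemanHorn.Theorems.IsogenyRedeiPolyMobiusTailStubKernelSumEq
import Summits.Parity.BatemanHorn.Theorems.IsogenyRedeiPolyMobiusTailStubCoeffAFunEqSum
import Summits.Parity.BatemanHorn.Theorems.IsogenyRedeiPolyMobiusTailStubEFunLogpowSummable
import Summits.Parity.BatemanHorn.Theorems.IsogenyRedeiPolyMobiusTailStubConvRate

/-!
# Crux `PolyMobiusTail` (stmt-Parity-0870), line `Sketch`: the registered stub `stub_kernel_two_le`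

Lead prover `prover-line-stmt-Parity-0870-c1-0`.  The `k`-variable hyperbolic Landau KERNEL of the line —
for a Bateman–Horn system `f`, a non-empty `S ⊆ Fin k` and `y ≥ 2`,
`|Σ_{d ∈ [1,y]^k, ∏dᵢ ≤ y} (∏ μ(dᵢ)) (∏_{i∉S} log dᵢ) ρ_f(d)/∏dᵢ| ≤ C/(log y)^{|S|+1}` —
assembled from the four landed stubs of skeleton v6 over the tree's Type-I-main-term apparatus
(`𝒶 = 𝓮 ⋆ ∏ 𝒻ᵢ` in `Λ_k`, stmt-Parity-0873):

* `stub_kernel_sum_eq` (K1): the kernel sum is `Σ_{m ≤ ⌊y⌋} [ε_{univ∖S}] 𝒶(m)`;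
* `stub_coeff_aFun_eq_sum` (K2): `[ε_T] 𝒶(m) = Σ_{J ⊆ T} ([ε_{T∖J}] 𝓮 ⋆ F_J)(m)`;
* `stub_eFun_logpow_summable` (K3): `Σ_n ‖𝓮(n)‖ (1 + log n)^B < ∞`;
* `stub_conv_rate` (K4): log-rate of `e ⋆ F` for absolutely log-summable `e`;
* tree: `hasLogRate_prod` + `mg_mgl_rate` + `mg_mgl_variation` give every `F_J`, `J ≠ univ`, partial sums
  `≪ (1 + log N)^{-(k+1)}` (some bare Möbius factor has limit `0`).

`component_rate` (one `J`), `kernel_of_stubs` (every `k`, every non-empty `S`), and the registered stub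
`stub_kernel_two_le` (`k ≥ 2`). Everything here is proved.
-/

open scoped BigOperators
open Filter Finset Polynomial Asymptotics

namespace Summit.Parity.BatemanHorn.Theorems.PolyMobiusTail.NaturalForm

open Literature.NumberTheory.Sieve
open Summit.Parity.BatemanHorn.Theorems.TypeIMainTerm

namespace KernelTwoLe

/-- The rate of one component `Σ_{m ≤ N} (E^{T∖J} ⋆ F_J)(m)` when `J ≠ univ`: `≤ C/(1 + log N)^{k+1}`. -/
theorem component_rate {k : ℕ} (f : Fin k → ℤ[X]) (hf : IsBatemanHornSystem f)
    (T J : Finset (Fin k)) (hJ : J ≠ Finset.univ) :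
    ∃ C : ℝ, 0 ≤ C ∧ ∀ N : ℕ, 1 ≤ N →
      |∑ m ∈ Finset.Ioc 0 N, (compE f (Finset.univ \ (T \ J)) * compF f J) m| ≤
        C / (1 + Real.log N) ^ (k + 1) := by
  classical
  have hρ : ∀ i p, p.Prime → polyRootCountMod ![f i] p < p := fun i p hp =>
    rootCount_member_lt f hf i hp
  have hdeg : ∀ i, 1 ≤ (f i).natDegree := natDegree_member_pos f hf
  set A : ℕ := k * (k + 2) + (k + 1) with hA
  obtain ⟨K, hK0, hK⟩ := mg_mgl_rate f hf.irreducible hdeg hf.leadingCoeff_pos hρ A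
  obtain ⟨M, hM1, hM⟩ := mg_mgl_variation f hf.irreducible hdeg
  -- the factors of `F_J`
  set G : Fin k → ArithmeticFunction ℝ := fun i => if i ∈ J then mgl f i else mg f i with hG
  set α : Fin k → ℝ := fun i => if i ∈ J then -batemanHornConst ![f i] else 0 with hα
  have hF : ∀ i, ∀ N : ℕ, 1 ≤ N → |∑ n ∈ Ioc 0 N, G i n - α i| ≤ K / (1 + Real.log N) ^ A := by
    intro i N hN
    by_cases hi : i ∈ J
    · simp only [hG, hα, if_pos hi]; exact (hK i).2 N hN
    · simp only [hG, hα, if_neg hi]; exact (hK i).1 N hN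
  have hV : ∀ i, ∀ N : ℕ, 1 ≤ N → ∑ n ∈ Ioc 0 N, |G i n| ≤ M * (1 + Real.log N) ^ 2 := by
    intro i N hN
    by_cases hi : i ∈ J
    · simp only [hG, if_pos hi]; exact (hM i).2 N hN
    · simp only [hG, if_neg hi]; exact (hM i).1 N hN
  obtain ⟨K', hK'0, hrate, hvar⟩ :=
    hasLogRate_prod k G α A K M hK0 hM1 (by rw [hA]; omega) hF hV
  have hA1 : A - k * (k + 2) = k + 1 := by rw [hA]; omega
  rw [hA1] at hrate
  -- `∏ α = 0` since some `i ∉ J`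
  obtain ⟨i₀, hi₀⟩ : ∃ i, i ∉ J := by
    by_contra h
    push Not at h
    exact hJ (Finset.eq_univ_iff_forall.mpr h)
  have hprod0 : ∏ i, α i = 0 :=
    Finset.prod_eq_zero (Finset.mem_univ i₀) (by simp only [hα, if_neg hi₀])
  have hFJ : compF f J = ∏ i, G i := rfl
  have hrate' : ∀ N : ℕ, 1 ≤ N → |∑ n ∈ Ioc 0 N, (compF f J) n| ≤ K' / (1 + Real.log N) ^ (k + 1) := by
    intro N hN
    have h := hrate N hN
    rwa [hprod0, sub_zero, ← hFJ] at h
  have hvar' : ∀ N : ℕ, 1 ≤ N → ∑ n ∈ Ioc 0 N, |(compF f J) n| ≤ M ^ k * (1 + Real.log N) ^ (2 * k) := by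
    intro N hN
    have h := hvar N hN
    rwa [← hFJ] at h
  -- the absolutely log-summable factor
  set B : ℕ := 2 * k + (k + 1) with hB
  have hsum := stub_eFun_logpow_summable k f hf.irreducible hf.pairwise_not_associated hρ B
  set E : ℝ := ∑' n : ℕ, SAlg.norm1 (eFun f n) * (1 + Real.log n) ^ B with hE
  have hterm0 : ∀ n : ℕ, 0 ≤ SAlg.norm1 (eFun f n) * (1 + Real.log n) ^ B := fun n =>
    mul_nonneg (SAlg.norm1_nonneg _) (pow_nonneg (by
      have := Real.log_natCast_nonneg n; linarith) _)
  have hE0 : 0 ≤ E := tsum_nonneg hterm0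
  set e : ArithmeticFunction ℝ := compE f (Finset.univ \ (T \ J)) with he
  have hepart : ∀ N : ℕ, ∑ n ∈ Ioc 0 N, |e n| * (1 + Real.log n) ^ B ≤ E := by
    intro N
    calc ∑ n ∈ Ioc 0 N, |e n| * (1 + Real.log n) ^ B
        ≤ ∑ n ∈ Ioc 0 N, SAlg.norm1 (eFun f n) * (1 + Real.log n) ^ B := by
          refine Finset.sum_le_sum fun n _ => ?_
          refine mul_le_mul_of_nonneg_right ?_ (pow_nonneg (by
            have := Real.log_natCast_nonneg n; linarith) _)
          rw [he, compE_apply]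
          exact SAlg.abs_coeff_le_norm1 _ _
      _ ≤ E := hsum.sum_le_tsum _ (fun n _ => hterm0 n)
  have hMk : 0 ≤ M ^ k := pow_nonneg (by linarith) k
  have hconv := stub_conv_rate e (compF f J) E K' (M ^ k) (k + 1) B (2 * k) hE0 hK'0 hMk hepart hrate' hvar'
  refine ⟨(4 : ℝ) ^ (k + 1) * E * K' + (4 : ℝ) ^ B * E * M ^ k, by positivity, fun N hN => ?_⟩
  have hL : 1 ≤ 1 + Real.log N := one_le_one_add_log hN
  have hL0 : 0 < 1 + Real.log N := by linarith
  refine (hconv N hN).trans (le_of_eq ?_)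
  have hB' : B = 2 * k + (k + 1) := hB
  rw [hB', pow_add (1 + Real.log N) (2 * k) (k + 1)]
  field_simp


/-- `log y ≤ 1 + log ⌊y⌋₊` for `y ≥ 1`. [folklore] -/
theorem log_le_one_add_log_floor {y : ℝ} (hy : 1 ≤ y) : Real.log y ≤ 1 + Real.log (⌊y⌋₊ : ℕ) := by
  have hN1 : (1 : ℝ) ≤ (⌊y⌋₊ : ℕ) := by exact_mod_cast Nat.le_floor (by exact_mod_cast hy)
  have hN0 : (0 : ℝ) < (⌊y⌋₊ : ℕ) := by linarith
  have hlt : y < (⌊y⌋₊ : ℕ) + 1 := Nat.lt_floor_add_one y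
  have h2N : y ≤ 2 * (⌊y⌋₊ : ℕ) := by linarith
  have hlog2 : Real.log 2 < 1 := by
    have := Real.log_two_lt_d9; linarith
  calc Real.log y ≤ Real.log (2 * (⌊y⌋₊ : ℕ)) := Real.log_le_log (by linarith) h2N
    _ = Real.log 2 + Real.log (⌊y⌋₊ : ℕ) := Real.log_mul (by norm_num) hN0.ne'
    _ ≤ 1 + Real.log (⌊y⌋₊ : ℕ) := by linarith

/-- **The kernel for every `k` and non-empty `S`** from the landed stubs K1–K4 and the tree. -/
theorem kernel_of_stubs :
    ∀ (k : ℕ) (f : Fin k → ℤ[X]),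
    Literature.NumberTheory.Sieve.IsBatemanHornSystem f → ∀ S : Finset (Fin k), S.Nonempty →
      ∃ C : ℝ, ∀ y : ℝ, 2 ≤ y →
        |∑ d ∈ Fintype.piFinset (fun _ : Fin k => Finset.Icc 1 ⌊y⌋₊),
            if ∏ i, (d i : ℝ) ≤ y then
              (∏ i, (ArithmeticFunction.moebius (d i) : ℝ)) * (∏ i ∈ Finset.univ \ S, Real.log (d i)) *
                ((((Finset.range (∏ i, d i)).filter
                    (fun n : ℕ => ∀ i, ((d i : ℕ) : ℤ) ∣ (f i).eval (n : ℤ))).card : ℝ) / ∏ i, (d i : ℝ))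
            else 0|
          ≤ C / Real.log y ^ (S.card + 1) := by
  intro k f hf S hS
  classical
  set T : Finset (Fin k) := Finset.univ \ S with hT
  obtain ⟨i₀, hi₀⟩ := hS
  have hJne : ∀ J ∈ T.powerset, J ≠ Finset.univ := by
    intro J hJ hJu
    have hi : i₀ ∈ J := hJu ▸ Finset.mem_univ i₀
    have hi' : i₀ ∈ T := Finset.mem_powerset.mp hJ hi
    rw [hT, Finset.mem_sdiff] at hi'
    exact hi'.2 hi₀
  have hcomp : ∀ J ∈ T.powerset, ∃ C : ℝ, 0 ≤ C ∧ ∀ N : ℕ, 1 ≤ N →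
      |∑ m ∈ Finset.Ioc 0 N, (compE f (Finset.univ \ (T \ J)) * compF f J) m| ≤
        C / (1 + Real.log N) ^ (k + 1) :=
    fun J hJ => component_rate f hf T J (hJne J hJ)
  choose! CJ hCJ0 hCJ using hcomp
  set Ctot : ℝ := ∑ J ∈ T.powerset, CJ J with hCtot
  have hCtot0 : 0 ≤ Ctot := Finset.sum_nonneg fun J hJ => hCJ0 J hJ
  refine ⟨Ctot, fun y hy => ?_⟩
  have hy0 : 0 ≤ y := by linarith
  have hy1 : 1 ≤ y := by linarith
  set N : ℕ := ⌊y⌋₊ with hN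
  have hN1 : 1 ≤ N := Nat.le_floor (by exact_mod_cast hy1)
  have hL1 : 1 ≤ 1 + Real.log N := one_le_one_add_log hN1
  -- K1 + K2: the kernel sum as a sum of components
  rw [stub_kernel_sum_eq k f S y hy0]
  have hexp : ∑ m ∈ Finset.Ioc 0 N, SAlg.coeff (aFun f m) (Finset.univ \ S) =
      ∑ J ∈ T.powerset, ∑ m ∈ Finset.Ioc 0 N, (compE f (Finset.univ \ (T \ J)) * compF f J) m := by
    rw [Finset.sum_comm]
    exact Finset.sum_congr rfl fun m _ => stub_coeff_aFun_eq_sum k f T m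
  rw [hexp]
  -- the bound `Ctot/(1 + log N)^{k+1}`
  have hmain : |∑ J ∈ T.powerset, ∑ m ∈ Finset.Ioc 0 N, (compE f (Finset.univ \ (T \ J)) * compF f J) m|
      ≤ Ctot / (1 + Real.log N) ^ (k + 1) := by
    calc |∑ J ∈ T.powerset, ∑ m ∈ Finset.Ioc 0 N, (compE f (Finset.univ \ (T \ J)) * compF f J) m|
        ≤ ∑ J ∈ T.powerset, |∑ m ∈ Finset.Ioc 0 N, (compE f (Finset.univ \ (T \ J)) * compF f J) m| :=
          Finset.abs_sum_le_sum_abs _ _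
      _ ≤ ∑ J ∈ T.powerset, CJ J / (1 + Real.log N) ^ (k + 1) :=
          Finset.sum_le_sum fun J hJ => hCJ J hJ N hN1
      _ = Ctot / (1 + Real.log N) ^ (k + 1) := by rw [hCtot, Finset.sum_div]
  refine hmain.trans ?_
  -- compare `(1 + log N)^{k+1}` with `(log y)^{|S|+1}`
  have hlogy0 : 0 < Real.log y := Real.log_pos (by linarith)
  have hlogyN : Real.log y ≤ 1 + Real.log N := log_le_one_add_log_floor hy1
  have hSk : S.card + 1 ≤ k + 1 := by
    have := S.card_le_univ; rw [Fintype.card_fin] at this; omega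
  rcases le_or_gt 1 (Real.log y) with h1 | h1
  · -- `log y ≥ 1`
    have hden : Real.log y ^ (S.card + 1) ≤ (1 + Real.log N) ^ (k + 1) :=
      (pow_le_pow_right₀ h1 hSk).trans (pow_le_pow_left₀ hlogy0.le hlogyN _)
    exact div_le_div_of_nonneg_left hCtot0 (pow_pos hlogy0 _) hden
  · -- `log y < 1`: the right side is at least `Ctot`
    have hle1 : Real.log y ^ (S.card + 1) ≤ 1 := pow_le_one₀ hlogy0.le h1.le
    have hpos : 0 < Real.log y ^ (S.card + 1) := pow_pos hlogy0 _
    calc Ctot / (1 + Real.log N) ^ (k + 1) ≤ Ctot := div_le_self hCtot0 (one_le_pow₀ hL1)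
      _ ≤ Ctot / Real.log y ^ (S.card + 1) := by
          rw [le_div_iff₀ hpos]
          exact mul_le_of_le_one_right hCtot0 hle1

end KernelTwoLe

/-- **Stub `stub_kernel_two_le`** (registered, skeleton v6 of line `Sketch`): for `k ≥ 2`, a Bateman–Horn
system `f`, a non-empty `S ⊆ Fin k` there is `C` with
`|Σ_{d ∈ [1,⌊y⌋]^k, ∏ dᵢ ≤ y} (∏ μ(dᵢ)) (∏_{i∉S} log dᵢ) · #{n < ∏dᵢ : dᵢ ∣ fᵢ(n) ∀ i}/∏dᵢ| ≤ C/(log y)^{|S|+1}`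
for all `y ≥ 2` (the `k`-variable hyperbolic Landau kernel). [folklore] -/
theorem stub_kernel_two_le : ∀ (k : ℕ), 2 ≤ k → ∀ (f : Fin k → ℤ[X]),
    Literature.NumberTheory.Sieve.IsBatemanHornSystem f → ∀ S : Finset (Fin k), S.Nonempty →
      ∃ C : ℝ, ∀ y : ℝ, 2 ≤ y →
        |∑ d ∈ Fintype.piFinset (fun _ : Fin k => Finset.Icc 1 ⌊y⌋₊),
            if ∏ i, (d i : ℝ) ≤ y then
              (∏ i, (ArithmeticFunction.moebius (d i) : ℝ)) * (∏ i ∈ Finset.univ \ S, Real.log (d i)) *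
                ((((Finset.range (∏ i, d i)).filter
                    (fun n : ℕ => ∀ i, ((d i : ℕ) : ℤ) ∣ (f i).eval (n : ℤ))).card : ℝ) / ∏ i, (d i : ℝ))
            else 0|
          ≤ C / Real.log y ^ (S.card + 1) :=
  fun k _ f hf S hS => KernelTwoLe.kernel_of_stubs k f hf S hS

end Summit.Parity.BatemanHorn.Theorems.PolyMobiusTail.NaturalForm
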